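import Literature.Computability.Complexity.CodeFPModArith
import HarnessLib

/-!
# The classical block functions of the cubic Gauss-sum experiment are polynomial time (van Dam–Seroussi, programs I)

Topic `Literature/Computability/Cryptography`; towards the discharge of
`VanDamSeroussi2002_cubicGaussSumPhase_qsolvable` (van Dam–Seroussi 2002, Thm. 1 for the cubic
residue character). The quantum circuit of the tree's route uses five garbage-free classical blocks
(Bennett compute–copy–uncompute around a polynomial-time machine, `RevClean.cleanOps`); each reads a
few registers copied, in the pair format `⟨r₁, ⟨r₂, …⟩⟩` of raw little-endian bit strings, onto its
data wires, and writes the binary numeral (`encodeNat`, little-endian, canonical) of one natural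
number, or one bit. This file defines the five functions and PROVES them polynomial-time on codes
(`Complexity.CodeFP`; arithmetic on numerals and residues from `CodeFPArith.lean`,
`CodeFPModArith.lean`), together with their arithmetic meaning:

* `flagVal` — the flag of the controlled state preparation: `c ∧ ¬(1 ≤ s < p ∧ s^{(p−1)/3} ≡ u^{c'})`,
  `u = r^{(p−1)/3}` (the complement of the coset `C_{c'}` of cubes; `codeFP_flagVal`);
* `combineVal x j p = x + j·p` (the repetition map `(x, j) ↦ x + jp`; `codeFP_combineVal`);
* `splitVal s p T = s mod p + T·(s div p)` with `T = 2ⁿ` (its inverse, both halves in one word;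
  `codeFP_splitVal`, `splitVal_combineVal`);
* `weightedExp Bper ctl = Σ_i ctl_i · 2^{⌊i/Bper⌋}` — the weighted exponent of the control string of
  Kitaev's tests (`Bper` tests per level) — and `peAddVal y ctl N Bper = (y + E) mod N`,
  `peSubVal v ctl N Bper = (v − E) mod N` (the move-and-add block of the eigenvalue measurement of
  the increment and its inverse; through `weightedExpMod`, the term-by-term reduced sum the machine
  actually computes, equal to `E mod N` for `N ≥ 2`; `codeFP_peAddVal`, `codeFP_peSubVal`,
  `peAddVal_eq`, `peSubVal_peAddVal`).

Everything is proved; definitions have bodies; no named fact is introduced.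

## References

* W. van Dam, G. Seroussi, arXiv:quant-ph/0207131 (2002), §2.1, §4 Algorithm 1, Thm. 1
  [VanDamSeroussi2002].
* A. Yu. Kitaev, arXiv:quant-ph/9511026 (1995), §3 Lemma 10 (controlled powers `U^{2^j}`)
  [Kitaev1995].
* S. Arora, B. Barak, *Computational Complexity: A Modern Approach*, CUP 2009, §1.3 (closure of
  polynomial time) [AroraBarak2009].
-/

noncomputable section

namespace Literature.Computability.Cryptography

namespace VanDamSeroussi

open _root_.Computability Literature.Computability.Complexity Literature.Computability.Complexity.CodeFP
  Literature.Computability.Complexity.ModArith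

/-! ### The functions -/

/-- **The flag of the controlled preparation.** `flagVal c s p r c'`: the control bit is on and the
register value `s` is NOT in the coset `C_{c'} = {1 ≤ s < p : s^{(p−1)/3} ≡ (r^{(p−1)/3})^{c'} (mod p)}`
of cubes. [cite: VanDamSeroussi2002, §2.1 (the character (p, g, α) = (p, r, (p-1)/3))] -/
def flagVal (c s p r cp : ℕ) : Bool :=
  decide (c = 1) && !(decide (1 ≤ s) && decide (s < p) &&
    decide (powM p s ((p - 1) / 3) = powM p (powM p r ((p - 1) / 3)) cp))

/-- **The repetition map** `(x, j) ↦ x + j·p`. [folklore] -/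
def combineVal (x j p : ℕ) : ℕ := x + j * p

/-- **Its inverse in one word**: `s ↦ s mod p + T·(s div p)` (`T = 2ⁿ ≥ p` puts the quotient behind the
`n` bits of the remainder). [folklore] -/
def splitVal (s p T : ℕ) : ℕ := s % p + T * (s / p)

/-- **The weighted exponent of a control string**: `Σ_i ctl_i · 2^{⌊i/Bper⌋}` (control `i` of Kitaev's
tests applies the `2^{⌊i/Bper⌋}`-th power; `Bper` tests per level). [cite: Kitaev1995, §3 Lemma 10] -/
def weightedExp (Bper : ℕ) (ctl : List Bool) : ℕ :=
  ((List.range ctl.length).zip ctl).foldr (fun ib acc => ib.2.toNat * 2 ^ (ib.1 / Bper) + acc) 0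

/-- The weighted exponent reduced modulo `N` AS THE MACHINE COMPUTES IT: every term `ctl_i · (2^{⌊i/Bper⌋} mod N)`
reduced, then the sum reduced (`ModArith.powM`, which is `0` at junk moduli `N ≤ 1`). [folklore] -/
def weightedExpMod (N Bper : ℕ) (ctl : List Bool) : ℕ :=
  (((List.range ctl.length).zip ctl).map fun ib => ib.2.toNat * powM N 2 (ib.1 / Bper) % N).sum % N

/-- **The move-and-add block of the eigenvalue measurement**: `(y + E(ctl)) mod N` (`N ≥ 2`;
`peAddVal_eq`). [cite: Kitaev1995, §3 Lemma 10] -/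
def peAddVal (y : ℕ) (ctl : List Bool) (N Bper : ℕ) : ℕ := (y + weightedExpMod N Bper ctl) % N

/-- **Its inverse**: `(v − E(ctl)) mod N` (`N ≥ 2`). [folklore] -/
def peSubVal (v : ℕ) (ctl : List Bool) (N Bper : ℕ) : ℕ := (v + (N - weightedExpMod N Bper ctl)) % N

/-! ### Arithmetic meaning -/

/-- `splitVal` inverts `combineVal` on `x < p`: the remainder is `x`, the quotient `j`. [folklore] -/
theorem splitVal_combineVal {x j p : ℕ} (hx : x < p) (T : ℕ) : splitVal (combineVal x j p) p T = x + T * j := by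
  have hp : 0 < p := by omega
  unfold splitVal combineVal
  rw [Nat.add_mul_mod_self_right, Nat.mod_eq_of_lt hx, Nat.add_mul_div_right _ _ hp, Nat.div_eq_of_lt hx,
    Nat.zero_add]

/-- The weighted exponent as a sum over the indexed bits. [folklore] -/
theorem weightedExp_eq_sum (Bper : ℕ) (ctl : List Bool) :
    weightedExp Bper ctl = (((List.range ctl.length).zip ctl).map fun ib => ib.2.toNat * 2 ^ (ib.1 / Bper)).sum := by
  unfold weightedExp
  induction ((List.range ctl.length).zip ctl) with
  | nil => rfl
  | cons a l ih => rw [List.foldr_cons, List.map_cons, List.sum_cons, ih]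

/-- For a genuine modulus the machine's reduced exponent is the exponent reduced. [folklore] -/
theorem weightedExpMod_eq {N : ℕ} (hN : 2 ≤ N) (Bper : ℕ) (ctl : List Bool) :
    weightedExpMod N Bper ctl = weightedExp Bper ctl % N := by
  rw [weightedExpMod, weightedExp_eq_sum]
  conv_rhs => rw [List.sum_nat_mod, List.map_map]
  congr 2
  refine List.map_congr_left fun ib _ => ?_
  simp only [Function.comp_apply, powM, if_pos hN]
  rw [Nat.mul_mod, Nat.mod_mod, ← Nat.mul_mod]

/-- `peAddVal` is addition of the weighted exponent modulo a genuine modulus. [folklore] -/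
theorem peAddVal_eq {N : ℕ} (hN : 2 ≤ N) (y : ℕ) (ctl : List Bool) (Bper : ℕ) :
    peAddVal y ctl N Bper = (y + weightedExp Bper ctl) % N := by
  rw [peAddVal, weightedExpMod_eq hN, Nat.add_mod, Nat.mod_mod, ← Nat.add_mod]

/-- The machine's reduced exponent is a residue. [folklore] -/
theorem weightedExpMod_lt {N : ℕ} (hN : 0 < N) (Bper : ℕ) (ctl : List Bool) : weightedExpMod N Bper ctl < N :=
  Nat.mod_lt _ hN

/-- `peSubVal` inverts `peAddVal` on `y < N`. [folklore] -/
theorem peSubVal_peAddVal {y N : ℕ} (hy : y < N) (ctl : List Bool) (Bper : ℕ) :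
    peSubVal (peAddVal y ctl N Bper) ctl N Bper = y := by
  have hN : 0 < N := by omega
  unfold peSubVal peAddVal
  have hElt : weightedExpMod N Bper ctl < N := weightedExpMod_lt hN Bper ctl
  rw [Nat.add_mod, Nat.mod_mod, ← Nat.add_mod]
  have : y + weightedExpMod N Bper ctl + (N - weightedExpMod N Bper ctl) = y + N := by omega
  rw [this, Nat.add_mod_right, Nat.mod_eq_of_lt hy]

/-! ### Polynomial time on codes -/

section Programs

/-- The input code of the flag block: `⟨[c], ⟨s, ⟨p, ⟨r, c'⟩⟩⟩⟩`, raw little-endian registers. [folklore] -/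
abbrev flagE : (List Bool × (List Bool × (List Bool × (List Bool × List Bool)))) → List Bool :=
  pairE strE (pairE strE (pairE strE (pairE strE strE)))

/-- **The flag is polynomial time on codes.** [cite: AroraBarak2009, §1.3] -/
theorem codeFP_flagVal : CodeFP flagE bitE (fun t => flagVal (bitsToNat t.1) (bitsToNat t.2.1)
    (bitsToNat t.2.2.1) (bitsToNat t.2.2.2.1) (bitsToNat t.2.2.2.2)) := by
  have hc : CodeFP flagE natE (fun t => bitsToNat t.1) := strVal.comp (fst _ _)
  have hs : CodeFP flagE natE (fun t => bitsToNat t.2.1) := strVal.comp (snd _ _).fst'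
  have hp : CodeFP flagE natE (fun t => bitsToNat t.2.2.1) := strVal.comp (snd _ _).snd'.fst'
  have hr : CodeFP flagE natE (fun t => bitsToNat t.2.2.2.1) := strVal.comp (snd _ _).snd'.snd'.fst'
  have hcp : CodeFP flagE natE (fun t => bitsToNat t.2.2.2.2) := strVal.comp (snd _ _).snd'.snd'.snd'
  have hthird : CodeFP flagE natE (fun t => (bitsToNat t.2.2.1 - 1) / 3) :=
    (natDiv.comp ((natSub.comp (hp.pair (const _ 1))).pair (const _ 3)) :)
  have hu : CodeFP flagE natE (fun t => powM (bitsToNat t.2.2.1) (bitsToNat t.2.2.2.1) ((bitsToNat t.2.2.1 - 1) / 3)) :=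
    modPow hp hr hthird
  have hlhs : CodeFP flagE natE (fun t => powM (bitsToNat t.2.2.1) (bitsToNat t.2.1) ((bitsToNat t.2.2.1 - 1) / 3)) :=
    modPow hp hs hthird
  have hrhs : CodeFP flagE natE (fun t => powM (bitsToNat t.2.2.1)
      (powM (bitsToNat t.2.2.1) (bitsToNat t.2.2.2.1) ((bitsToNat t.2.2.1 - 1) / 3)) (bitsToNat t.2.2.2.2)) :=
    modPow hp hu hcp
  have hc1 : CodeFP flagE bitE (fun t => decide (bitsToNat t.1 = 1)) := (natEq.comp (hc.pair (const _ 1)) :)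
  have h1s : CodeFP flagE bitE (fun t => decide (1 ≤ bitsToNat t.2.1)) := (natLe.comp ((const _ 1).pair hs) :)
  have hsp : CodeFP flagE bitE (fun t => decide (bitsToNat t.2.1 < bitsToNat t.2.2.1)) := (natLt.comp (hs.pair hp) :)
  have heq : CodeFP flagE bitE (fun t => decide (powM (bitsToNat t.2.2.1) (bitsToNat t.2.1) ((bitsToNat t.2.2.1 - 1) / 3) =
      powM (bitsToNat t.2.2.1) (powM (bitsToNat t.2.2.1) (bitsToNat t.2.2.2.1) ((bitsToNat t.2.2.1 - 1) / 3))
        (bitsToNat t.2.2.2.2))) := (natEq.comp (hlhs.pair hrhs) :)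
  exact (hc1.and ((h1s.and (hsp.and heq)).not)).congr fun t => by
    unfold flagVal; simp only [Bool.and_assoc]

/-- The input code of the repetition block: `⟨x, ⟨j, p⟩⟩`. [folklore] -/
abbrev combineE : (List Bool × (List Bool × List Bool)) → List Bool := pairE strE (pairE strE strE)

/-- **The repetition map is polynomial time on codes.** [cite: AroraBarak2009, §1.3] -/
theorem codeFP_combineVal :
    CodeFP combineE natE (fun t => combineVal (bitsToNat t.1) (bitsToNat t.2.1) (bitsToNat t.2.2)) := by
  have hx : CodeFP combineE natE (fun t => bitsToNat t.1) := strVal.comp (fst _ _)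
  have hj : CodeFP combineE natE (fun t => bitsToNat t.2.1) := strVal.comp (snd _ _).fst'
  have hp : CodeFP combineE natE (fun t => bitsToNat t.2.2) := strVal.comp (snd _ _).snd'
  exact ((natAdd.comp (hx.pair (natMul.comp (hj.pair hp)))).congr fun t => rfl :)

/-- **The splitting map is polynomial time on codes** (input `⟨s, ⟨p, T⟩⟩`). [cite: AroraBarak2009, §1.3] -/
theorem codeFP_splitVal :
    CodeFP combineE natE (fun t => splitVal (bitsToNat t.1) (bitsToNat t.2.1) (bitsToNat t.2.2)) := by
  have hs : CodeFP combineE natE (fun t => bitsToNat t.1) := strVal.comp (fst _ _)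
  have hp : CodeFP combineE natE (fun t => bitsToNat t.2.1) := strVal.comp (snd _ _).fst'
  have hT : CodeFP combineE natE (fun t => bitsToNat t.2.2) := strVal.comp (snd _ _).snd'
  exact ((natAdd.comp ((natMod.comp (hs.pair hp)).pair (natMul.comp (hT.pair (natDiv.comp (hs.pair hp)))))).congr
    fun t => rfl :)

/-- The bits of a string as a raw list of one-symbol strings. [folklore] -/
theorem codeFP_strBits : CodeFP strE (rawE strE) (fun w => (List.range w.length).map fun i => [w.getD i false]) := by
  have h := strChunks.comp (strLength.pair ((const strE 1).pair (CodeFP.id strE)))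
  refine h.congr fun w => ?_
  refine List.map_congr_left fun i hi => ?_
  have hi' : i < w.length := by simpa using hi
  show List.take 1 (List.drop (i * 1) w) = [w.getD i false]
  rw [mul_one, List.take_one_drop_eq_of_lt_length hi', List.getD_eq_getElem _ _ hi', List.get_eq_getElem]

/-- The input code of the move-and-add block: `⟨y, ⟨ctl, ⟨N, Bper⟩⟩⟩`. [folklore] -/
abbrev peE : (List Bool × (List Bool × (List Bool × List Bool))) → List Bool :=
  pairE strE (pairE strE (pairE strE strE))

/-- The machine's reduced weighted exponent is polynomial time on codes: enumerate the bits, reduce each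
term `ctl_i · 2^{⌊i/Bper⌋}` modulo `N`, sum modulo `N`. [cite: AroraBarak2009, §1.3] -/
theorem codeFP_weightedExpMod :
    CodeFP peE natE (fun t => weightedExpMod (bitsToNat t.2.2.1) (bitsToNat t.2.2.2) t.2.1) := by
  classical
  -- context `(N, Bper)` and the indexed bits
  have hN : CodeFP peE natE (fun t => bitsToNat t.2.2.1) := strVal.comp (snd _ _).snd'.fst'
  have hB : CodeFP peE natE (fun t => bitsToNat t.2.2.2) := strVal.comp (snd _ _).snd'.snd'
  have hbits : CodeFP peE (rawE (pairE natE strE))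
      (fun t => (List.range t.2.1.length).zip ((List.range t.2.1.length).map fun i => [t.2.1.getD i false])) :=
    ((rawEnum strE).comp (codeFP_strBits.comp (snd _ _).fst')).congr fun t => by simp
  -- the term of an indexed bit, in context `(N, Bper)`
  set σE : (ℕ × ℕ) → List Bool := pairE natE natE with hσE
  have hctx : CodeFP peE σE (fun t => (bitsToNat t.2.2.1, bitsToNat t.2.2.2)) := hN.pair hB
  have hterm : CodeFP (pairE σE (pairE natE strE)) natE
      (fun q => mulM q.1.1 (bitsToNat q.2.2) (powM q.1.1 2 (q.2.1 / q.1.2))) :=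
    modMul ((fst _ _).fst') (strVal.comp (snd _ _).snd')
      (modPow ((fst _ _).fst') (const _ 2) (natDiv.comp ((snd _ _).fst'.pair (fst _ _).snd')))
  have hmap := (map (σ := ℕ × ℕ) (eσ := σE) hterm).comp (hctx.pair hbits)
  have hsum := sumMod.comp (hN.pair hmap)
  refine hsum.congr fun t => ?_
  obtain ⟨y, ctl, Ns, Bs⟩ := t
  dsimp only
  rw [sumM_eq, weightedExpMod]
  congr 2
  -- the two indexed lists agree term by term
  have hzip : (List.range ctl.length).zip ((List.range ctl.length).map fun i => [ctl.getD i false]) =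
      ((List.range ctl.length).zip ctl).map fun ib => (ib.1, [ib.2]) := by
    apply List.ext_getElem
    · simp
    · intro i h1 h2
      simp only [List.length_zip, List.length_range, List.length_map, min_self] at h1
      have hi : i < ctl.length := by omega
      simp [List.getElem_zip, hi]
  rw [hzip, List.map_map]
  refine List.map_congr_left fun ib _ => ?_
  simp [mulM]

/-- **The move-and-add block is polynomial time on codes.** [cite: AroraBarak2009, §1.3] -/
theorem codeFP_peAddVal :
    CodeFP peE natE (fun t => peAddVal (bitsToNat t.1) t.2.1 (bitsToNat t.2.2.1) (bitsToNat t.2.2.2)) := by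
  have hy : CodeFP peE natE (fun t => bitsToNat t.1) := strVal.comp (fst _ _)
  have hN : CodeFP peE natE (fun t => bitsToNat t.2.2.1) := strVal.comp (snd _ _).snd'.fst'
  exact (modAdd hN hy codeFP_weightedExpMod).congr fun t => rfl

/-- **Its inverse is polynomial time on codes.** [cite: AroraBarak2009, §1.3] -/
theorem codeFP_peSubVal :
    CodeFP peE natE (fun t => peSubVal (bitsToNat t.1) t.2.1 (bitsToNat t.2.2.1) (bitsToNat t.2.2.2)) := by
  have hy : CodeFP peE natE (fun t => bitsToNat t.1) := strVal.comp (fst _ _)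
  have hN : CodeFP peE natE (fun t => bitsToNat t.2.2.1) := strVal.comp (snd _ _).snd'.fst'
  exact (natMod.comp ((natAdd.comp (hy.pair (natSub.comp (hN.pair codeFP_weightedExpMod)))).pair hN)).congr
    fun t => rfl

end Programs

end VanDamSeroussi

end Literature.Computability.Cryptography
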